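import Literature.MathematicalPhysics.QuantumFieldTheory.Balaban1983to89.Node00.WilsonActionSecondVariationGauge
import Literature.MathematicalPhysics.QuantumFieldTheory.Balaban1983to89.B16Ineq19FlatSliceChart

/-!
# NODE 00 — THE SECOND VARIATION OF THE WILSON ACTION (5), V: THE LEFT-CHART DICTIONARY AT A GENERAL BACKGROUND — `exp(Y_b)·U_b = U_b·exp(U_b⁻¹Y_bU_b)`, so every
# right-chart statement of the U2a files holds for print's LEFT perturbation `U′U₀` ([B9] (3.1), [B16] (1.16)∕(1.19), [15] Prop. 9 «V′V₀») with `X := Ad_{U⁻¹}Y`; the left-chart letter (b)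
# `|Q^L_U(Y) − Q_1(Y)| ≤ 8·Σ_p δ_p(Σ_k‖Y_{b_k}‖)²`; and, at `SU(2)`, ONE rewrite `expMul su2Chart A U = expChart U (Ad_{U⁻¹} ∘ φ ∘ A)` for the N12∕s1 slice chain

Cell `pub-ymgap`, WIDTH SEAT `pub-ymgap-dag-n12-w2` generation 0 (HUMAN RULING D-0149 ∕ director-ym №197; DAG node N12 = [B15]; successor piece (S4) on the lane's word dag-n12-c g16 l.25743;
INBOX INTENT-7 l.25815).  CONSUMED BY NAME: this seat's p583639–p589772 (`Node00.expChart` second variations, `abs_deriv_deriv_wilsonAction4_expChart_le`, `…_sub_flat_le_local`,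
`deriv_deriv_wilsonAction4_expChart_one`, `norm_coe_specialUnitaryAd`), `T4AdjointCovarianceUnitary.specialUnitaryAd`∕`expSU_specialUnitaryAd`, dag-n12-w3's `B16Ineq19FlatSliceChart.expPoint_eq_expSU`
(the `ℝ³ ≅ 𝔰𝔲(2)` coordinate `φ`, hypothesis-style), dag-n12-c's `B16Sect1Backgrounds.expMul` ∕ `B15Prop1ChartSU2.su2Chart`.  `--kind proof --supports stmt-QuantumFields-20542` (K1⁷; count-neutral).

PRINT.  [B9] = [Balaban1985BackgroundPropagators] p. 390 (3.1): «We take U = U′U₀, U′ = exp iηA» (LEFT perturbation); [B16] = [Balaban1989LargeFieldII] p. 360 (1.16), (1.19): «exp iη𝐇·U», «V′ = exp ig_kB»;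
p. 357: «The leading term in the expansion is the quadratic form with the background field identically equal to 1»; [Balaban1985Averaging] (57) p. 27: «R(X)f(Y) = f(R(X)Y) for analytic functions f».
READING.  n07-e∕n12-w2's chart of record multiplies on the RIGHT (`Node00.expChart U X = (b ↦ U_b·exp X_b)`), n12-c's slice chain on the LEFT (`expMul su2Chart A U = (b ↦ exp(iA_b)·U_b)`); they differ by the
bond-wise adjoint action `X_b = U_b⁻¹Y_bU_b = Ad_{U_b⁻¹}Y_b` (an isometry of the letters in the operator norm (19)); at `U ≡ 1` they coincide (n12-w3's `expMul_su2Chart_one_eq_expChart`).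

CONTENTS (theorems only; no `def`, no `instance`).  `Q_U(X) := deriv (deriv (t ↦ A(U·e^{tX}))) 0` (right), `Q^L_U(Y) := deriv (deriv (t ↦ A(e^{tY}·U))) 0` (left), `s_p(Z) = Σ_k‖Z_{b_k}‖`.
* §1 (any `SU(N)`): `expSU_specialUnitaryAd_inv`, `expSU_mul_eq_mul_expSU` (`exp(Y)·g = g·exp(Ad_{g⁻¹}Y)`), ★ `leftChart_eq_expChart` (`(b ↦ e^{Y_b}U_b) = expChart U (Ad_{U⁻¹}Y)`),
  `leftChart_smul_eq_expChart_smul`, `wilsonAction4_leftChart_smul_eq` (the two action curves are the SAME function of `t`), ★ `deriv_deriv_wilsonAction4_leftChart_eq` (`Q^L_U(Y) = Q_U(Ad_{U⁻¹}Y)`).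
* §2 the left-chart letters: `abs_deriv_deriv_wilsonAction4_leftChart_le` (`|Q^L_U(Y)| ≤ Σ_p s_p(Y)²`), `norm_coe_specialUnitaryAd_inv_sub_le` (`‖Ad_{g⁻¹}Y − Y‖ ≤ 2‖g−1‖‖Y‖`), `abs_flat_sub_flat_le`
  (`|Q_1(X) − Q_1(X′)| ≤ Σ_p (s_p(X)+s_p(X′))·s_p(X−X′)` — the flat form is a bounded quadratic form), ★★ `abs_deriv_deriv_wilsonAction4_leftChart_sub_flat_le_local` (`|Q^L_U(Y) − Q_1(Y)| ≤ 8·Σ_p δ_p s_p(Y)²`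
  when `‖U_b − 1‖ ≤ δ_p` on the bonds of `p`: letter (b) of the U2 lane in the LEFT chart).
* §3 (`SU(2)`, any `φ` with `↑(φ v) = quatMatrix (ι v)`): ★ `expMul_su2Chart_eq_expChart` (`expMul su2Chart A U = expChart U (b ↦ Ad_{(U b)⁻¹}(φ (A b)))`), `expMul_su2Chart_smul_eq_expChart`,
  `wilsonAction4_expMul_su2Chart_smul_eq` — ONE rewrite carrying every right-chart theorem to the slice chain's chart at a general background.

HONEST FRAMING: bookkeeping and one elementary estimate about the tree's own action functional; nothing of Bałaban's estimates; count-neutral; N12 NOT discharged (5∕27 unmoved); finite 𝕋⁴ at fixed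
ε, Bałaban AS PRINTED with locators; R4 closes the conditional rung `BalabanLadder.UV` only — NOT continuum ∕ ℝ⁴ ∕ OS ∕ mass gap ∕ Clay.  No `sorry`, no `def`, no `instance`.
-/

noncomputable section

namespace Literature.MathematicalPhysics.QuantumFieldTheory.Balaban1983to89.Node00

open T4AdjointCovarianceUnitary (lieSU expSU coe_expSU specialUnitaryAd coe_specialUnitaryAd expSU_specialUnitaryAd)
open scoped Matrix.Norms.L2Operator

/-! ## §1  `exp(Y)·g = g·exp(Ad_{g⁻¹}Y)`: the left chart is the right chart at the conjugated direction -/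

section Dictionary

variable {P : Params} {j : ℕ} {N : ℕ}

/-- `expSU (Ad_{g⁻¹}Y) = g⁻¹·expSU Y·g` («R(X)f(Y) = f(R(X)Y)», the tree's `expSU_specialUnitaryAd` at `g⁻¹`). [cite: Balaban1985Averaging, (57) p.27] -/
theorem expSU_specialUnitaryAd_inv (g : SU N) (Y : lieSU (Fin N)) : expSU (specialUnitaryAd g⁻¹ Y) = g⁻¹ * expSU Y * g := by
  rw [expSU_specialUnitaryAd, inv_inv]

/-- ★ (i) **`exp(Y)·g = g·exp(Ad_{g⁻¹}Y)`** in `SU(N)`. [cite: Balaban1985Averaging, (57) p.27; Balaban1985BackgroundPropagators, (3.1) p.390] -/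
theorem expSU_mul_eq_mul_expSU (Y : lieSU (Fin N)) (g : SU N) : expSU Y * g = g * expSU (specialUnitaryAd g⁻¹ Y) := by
  rw [expSU_specialUnitaryAd_inv, ← mul_assoc, ← mul_assoc, mul_inv_cancel, one_mul]

/-- ★ **THE LEFT CHART IS THE RIGHT CHART AT `Ad_{U⁻¹}Y`**: `(b ↦ exp(Y_b)·U_b) = expChart U (b ↦ Ad_{U_b⁻¹}Y_b)` — print's `U′U₀` ([B9] (3.1), [B16] (1.16)) in n07-e's chart of record.
[cite: Balaban1985BackgroundPropagators, (3.1) p.390; Balaban1989LargeFieldII, (1.16) p.360] -/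
theorem leftChart_eq_expChart (U : GaugeField P j (SU N)) (Y : PBond P j → lieSU (Fin N)) :
    (fun b => expSU (Y b) * U b) = expChart U (fun b => specialUnitaryAd (U b)⁻¹ (Y b)) := by
  funext b
  exact expSU_mul_eq_mul_expSU (Y b) (U b)

/-- The ray version: `(b ↦ exp(tY_b)·U_b) = expChart U (t • Ad_{U⁻¹}Y)`. [cite: Balaban1985BackgroundPropagators, (3.1)–(3.2) p.390] -/
theorem leftChart_smul_eq_expChart_smul (U : GaugeField P j (SU N)) (Y : PBond P j → lieSU (Fin N)) (t : ℝ) :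
    (fun b => expSU ((t • Y) b) * U b) = expChart U (t • fun b => specialUnitaryAd (U b)⁻¹ (Y b)) := by
  rw [leftChart_eq_expChart]
  congr 1
  funext b
  simp only [Pi.smul_apply, map_smul]

variable [NeZero N]

/-- The action along the left ray IS the action along the right ray at `Ad_{U⁻¹}Y` (same function of `t`). [cite: Balaban1985BackgroundPropagators, (3.1) p.390, (3.7) p.391] -/
theorem wilsonAction4_leftChart_smul_eq (U : GaugeField P j (SU N)) (Y : PBond P j → lieSU (Fin N)) :
    (fun t : ℝ => wilsonAction4 (fun b => expSU ((t • Y) b) * U b)) = fun t : ℝ => wilsonAction4 (expChart U (t • fun b => specialUnitaryAd (U b)⁻¹ (Y b))) := by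
  funext t
  rw [leftChart_smul_eq_expChart_smul]

/-- ★ (ii) **`Q^L_U(Y) = Q_U(Ad_{U⁻¹}Y)`**: the second variation in print's left chart is the right-chart second variation of the U2a files (p583639 `hasDerivAt_deriv_wilsonAction4_expChart`,
p585069∕p587195 letters and bounds) at the conjugated direction — and likewise every other derivative. [cite: Balaban1985BackgroundPropagators, (3.6)–(3.7) p.391; Balaban1989LargeFieldII, (1.12) p.359] -/
theorem deriv_deriv_wilsonAction4_leftChart_eq (U : GaugeField P j (SU N)) (Y : PBond P j → lieSU (Fin N)) :
    deriv (deriv fun t : ℝ => wilsonAction4 (fun b => expSU ((t • Y) b) * U b)) 0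
      = deriv (deriv fun t : ℝ => wilsonAction4 (expChart U (t • fun b => specialUnitaryAd (U b)⁻¹ (Y b)))) 0 := by
  rw [wilsonAction4_leftChart_smul_eq]

end Dictionary

/-! ## §2  The left-chart letters: Hessian bound, and letter (b) with the letter change `Ad_{U⁻¹}Y ↔ Y` -/

section Letters

variable {P : Params} {j : ℕ} {N : ℕ} [NeZero N]

/-- **`|Q^L_U(Y)| ≤ Σ_p (Σ_k‖Y_{b_k}‖)²`** — p587195's bound at `Ad_{U⁻¹}Y`, the operator-norm letters being Ad-invariant. [cite: Balaban1985BackgroundPropagators, (3.10) p.392; Balaban1985Averaging, (20) p.21] -/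
theorem abs_deriv_deriv_wilsonAction4_leftChart_le (U : GaugeField P j (SU N)) (Y : PBond P j → lieSU (Fin N)) :
    |deriv (deriv fun t : ℝ => wilsonAction4 (fun b => expSU ((t • Y) b) * U b)) 0| ≤ ∑ p : Plaq P j, (‖(Y ⟨p.src, p.μ⟩ : Matrix (Fin N) (Fin N) ℂ)‖ + ‖(Y ⟨p.src.shift p.μ, p.ν⟩ : Matrix (Fin N) (Fin N) ℂ)‖ + ‖(Y ⟨p.src.shift p.ν, p.μ⟩ : Matrix (Fin N) (Fin N) ℂ)‖ + ‖(Y ⟨p.src, p.ν⟩ : Matrix (Fin N) (Fin N) ℂ)‖) ^ 2 := by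
  rw [deriv_deriv_wilsonAction4_leftChart_eq]
  have h := abs_deriv_deriv_wilsonAction4_expChart_le U (fun b => specialUnitaryAd (U b)⁻¹ (Y b))
  simp only [norm_coe_specialUnitaryAd] at h
  exact h

omit [NeZero N] in
/-- The letter change costs the bond deviation: `‖Ad_{g⁻¹}Y − Y‖ = ‖g⋆Yg − Y‖ ≤ 2‖g − 1‖·‖Y‖` (`g⋆Yg − Y = (g⋆ − 1)Yg + Y(g − 1)`). [cite: Balaban1985Averaging, (19)–(20) p.21 (bookkeeping)] -/
theorem norm_coe_specialUnitaryAd_inv_sub_le (g : SU N) (Y : lieSU (Fin N)) :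
    ‖((specialUnitaryAd g⁻¹ Y : lieSU (Fin N)) : Matrix (Fin N) (Fin N) ℂ) - (Y : Matrix (Fin N) (Fin N) ℂ)‖ ≤ 2 * ‖(g : Matrix (Fin N) (Fin N) ℂ) - 1‖ * ‖(Y : Matrix (Fin N) (Fin N) ℂ)‖ := by
  rw [coe_specialUnitaryAd, coe_inv_SU, star_star]
  have hg : (g : Matrix (Fin N) (Fin N) ℂ) ∈ unitary (Matrix (Fin N) (Fin N) ℂ) := g.2.1
  have h : star (g : Matrix (Fin N) (Fin N) ℂ) * (Y : Matrix (Fin N) (Fin N) ℂ) * (g : Matrix (Fin N) (Fin N) ℂ) - (Y : Matrix (Fin N) (Fin N) ℂ)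
      = (star (g : Matrix (Fin N) (Fin N) ℂ) - 1) * (Y : Matrix (Fin N) (Fin N) ℂ) * (g : Matrix (Fin N) (Fin N) ℂ) + (Y : Matrix (Fin N) (Fin N) ℂ) * ((g : Matrix (Fin N) (Fin N) ℂ) - 1) := by noncomm_ring
  rw [h]
  refine (norm_add_le _ _).trans ?_
  rw [CStarRing.norm_mul_mem_unitary _ hg]
  have e1 : ‖(star (g : Matrix (Fin N) (Fin N) ℂ) - 1) * (Y : Matrix (Fin N) (Fin N) ℂ)‖ ≤ ‖(g : Matrix (Fin N) (Fin N) ℂ) - 1‖ * ‖(Y : Matrix (Fin N) (Fin N) ℂ)‖ :=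
    (norm_mul_le _ _).trans (by rw [norm_star_sub_one])
  have e2 : ‖(Y : Matrix (Fin N) (Fin N) ℂ) * ((g : Matrix (Fin N) (Fin N) ℂ) - 1)‖ ≤ ‖(g : Matrix (Fin N) (Fin N) ℂ) - 1‖ * ‖(Y : Matrix (Fin N) (Fin N) ℂ)‖ := (norm_mul_le _ _).trans (by rw [mul_comm])
  linarith

/-- **THE FLAT FORM IS A BOUNDED QUADRATIC FORM**: `|Q_1(X) − Q_1(X′)| ≤ Σ_p (s_p(X) + s_p(X′))·s_p(X − X′)` (`Q_1(Z) = (1∕N)Σ_p Re Tr(σ⁰_p(Z)⋆σ⁰_p(Z))`, `σ⁰` linear,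
`Re Tr(a⋆a) − Re Tr(b⋆b) = Re Tr((a−b)⋆a) + Re Tr(b⋆(a−b))`, B7 (20)). [cite: Balaban1989LargeFieldII, p.357; Balaban1985Averaging, (20) p.21] -/
theorem abs_flat_sub_flat_le (X X' : PBond P j → lieSU (Fin N)) :
    |deriv (deriv fun t : ℝ => wilsonAction4 (expChart (1 : GaugeField P j (SU N)) (t • X))) 0
        - deriv (deriv fun t : ℝ => wilsonAction4 (expChart (1 : GaugeField P j (SU N)) (t • X'))) 0|
      ≤ ∑ p : Plaq P j, ((‖(X ⟨p.src, p.μ⟩ : Matrix (Fin N) (Fin N) ℂ)‖ + ‖(X ⟨p.src.shift p.μ, p.ν⟩ : Matrix (Fin N) (Fin N) ℂ)‖ + ‖(X ⟨p.src.shift p.ν, p.μ⟩ : Matrix (Fin N) (Fin N) ℂ)‖ + ‖(X ⟨p.src, p.ν⟩ : Matrix (Fin N) (Fin N) ℂ)‖) + (‖(X' ⟨p.src, p.μ⟩ : Matrix (Fin N) (Fin N) ℂ)‖ + ‖(X' ⟨p.src.shift p.μ, p.ν⟩ : Matrix (Fin N) (Fin N) ℂ)‖ + ‖(X' ⟨p.src.shift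 p.ν, p.μ⟩ : Matrix (Fin N) (Fin N) ℂ)‖ + ‖(X' ⟨p.src, p.ν⟩ : Matrix (Fin N) (Fin N) ℂ)‖))
          * (‖(X ⟨p.src, p.μ⟩ : Matrix (Fin N) (Fin N) ℂ) - (X' ⟨p.src, p.μ⟩ : Matrix (Fin N) (Fin N) ℂ)‖ + ‖(X ⟨p.src.shift p.μ, p.ν⟩ : Matrix (Fin N) (Fin N) ℂ) - (X' ⟨p.src.shift p.μ, p.ν⟩ : Matrix (Fin N) (Fin N) ℂ)‖
            + ‖(X ⟨p.src.shift p.ν, p.μ⟩ : Matrix (Fin N) (Fin N) ℂ) - (X' ⟨p.src.shift p.ν, p.μ⟩ : Matrix (Fin N) (Fin N) ℂ)‖ + ‖(X ⟨p.src, p.ν⟩ : Matrix (Fin N) (Fin N) ℂ) - (X' ⟨p.src, p.ν⟩ : Matrix (Fin N) (Fin N) ℂ)‖) := by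
  rw [deriv_deriv_wilsonAction4_expChart_one, deriv_deriv_wilsonAction4_expChart_one, ← sub_div, ← Finset.sum_sub_distrib, abs_div, Nat.abs_cast,
    div_le_iff₀ (Nat.cast_pos.mpr (Fintype.card_pos (α := Fin N))), Finset.sum_mul]
  refine (Finset.abs_sum_le_sum_abs _ _).trans (Finset.sum_le_sum fun p _ => ?_)
  -- per plaquette: `a = σ⁰(X)`, `b = σ⁰(X′)`
  have key : ∀ a b : Matrix (Fin N) (Fin N) ℂ, |(Matrix.trace (star a * a)).re - (Matrix.trace (star b * b)).re| ≤ (Fintype.card (Fin N) : ℝ) * ((‖a‖ + ‖b‖) * ‖a - b‖) := by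
    intro a b
    have hid : star a * a - star b * b = star (a - b) * a + star b * (a - b) := by rw [star_sub]; noncomm_ring
    rw [← Complex.sub_re, ← Matrix.trace_sub, hid, Matrix.trace_add, Complex.add_re]
    have h1 := MatrixNorms.abs_nReTr_le_opNorm (star (a - b) * a)
    have h2 := MatrixNorms.abs_nReTr_le_opNorm (star b * (a - b))
    unfold UnitaryModel.nReTr at h1 h2
    rw [abs_div, Nat.abs_cast, div_le_iff₀ (Nat.cast_pos.mpr (Fintype.card_pos (α := Fin N)))] at h1 h2
    have n1 : ‖star (a - b) * a‖ ≤ ‖a - b‖ * ‖a‖ := (norm_mul_le _ _).trans (by rw [norm_star])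
    have n2 : ‖star b * (a - b)‖ ≤ ‖b‖ * ‖a - b‖ := (norm_mul_le _ _).trans (by rw [norm_star])
    have hN : (0 : ℝ) ≤ (Fintype.card (Fin N) : ℝ) := Nat.cast_nonneg _
    calc |(Matrix.trace (star (a - b) * a)).re + (Matrix.trace (star b * (a - b))).re|
        ≤ |(Matrix.trace (star (a - b) * a)).re| + |(Matrix.trace (star b * (a - b))).re| := abs_add_le _ _
      _ ≤ ‖star (a - b) * a‖ * (Fintype.card (Fin N) : ℝ) + ‖star b * (a - b)‖ * (Fintype.card (Fin N) : ℝ) := add_le_add h1 h2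
      _ ≤ ‖a - b‖ * ‖a‖ * (Fintype.card (Fin N) : ℝ) + ‖b‖ * ‖a - b‖ * (Fintype.card (Fin N) : ℝ) := by gcongr
      _ = (Fintype.card (Fin N) : ℝ) * ((‖a‖ + ‖b‖) * ‖a - b‖) := by ring
  refine (key _ _).trans ?_
  rw [mul_comm]
  refine mul_le_mul_of_nonneg_right ?_ (Nat.cast_nonneg _)
  have hσ : ∀ Z : PBond P j → lieSU (Fin N), ‖((Z ⟨p.src, p.μ⟩ : Matrix (Fin N) (Fin N) ℂ) + (Z ⟨p.src.shift p.μ, p.ν⟩ : Matrix (Fin N) (Fin N) ℂ) - (Z ⟨p.src.shift p.ν, p.μ⟩ : Matrix (Fin N) (Fin N) ℂ) - (Z ⟨p.src, p.ν⟩ : Matrix (Fin N) (Fin N) ℂ))‖ ≤ (‖(Z ⟨p.src, p.μ⟩ : Matrix (Fin N) (Fin N) ℂ)‖ + ‖(Z ⟨p.src.shift p.μ, p.ν⟩ : Matrix (Fin N) (Fin N) ℂ)‖ + ‖(Z ⟨p.src.shift p.ν, p.μ⟩ : Matrix (Fin N) (Fin N) ℂ)‖ + ‖(Z ⟨p.src,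 p.ν⟩ : Matrix (Fin N) (Fin N) ℂ)‖) := fun Z =>
    (norm_sub_le _ _).trans (add_le_add ((norm_sub_le _ _).trans (add_le_add (norm_add_le _ _) le_rfl)) le_rfl)
  have hd : ‖((X ⟨p.src, p.μ⟩ : Matrix (Fin N) (Fin N) ℂ) + (X ⟨p.src.shift p.μ, p.ν⟩ : Matrix (Fin N) (Fin N) ℂ) - (X ⟨p.src.shift p.ν, p.μ⟩ : Matrix (Fin N) (Fin N) ℂ) - (X ⟨p.src, p.ν⟩ : Matrix (Fin N) (Fin N) ℂ)) - ((X' ⟨p.src, p.μ⟩ : Matrix (Fin N) (Fin N) ℂ) + (X' ⟨p.src.shift p.μ, p.ν⟩ : Matrix (Fin N) (Fin N) ℂ) - (X' ⟨p.src.shift p.ν, p.μ⟩ : Matrix (Fin N) (Fin N) ℂ) - (X' ⟨p.src, p.ν⟩ : Matrix (Fin N) (Fin N) ℂ))‖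
      ≤ ‖(X ⟨p.src, p.μ⟩ : Matrix (Fin N) (Fin N) ℂ) - (X' ⟨p.src, p.μ⟩ : Matrix (Fin N) (Fin N) ℂ)‖ + ‖(X ⟨p.src.shift p.μ, p.ν⟩ : Matrix (Fin N) (Fin N) ℂ) - (X' ⟨p.src.shift p.μ, p.ν⟩ : Matrix (Fin N) (Fin N) ℂ)‖
        + ‖(X ⟨p.src.shift p.ν, p.μ⟩ : Matrix (Fin N) (Fin N) ℂ) - (X' ⟨p.src.shift p.ν, p.μ⟩ : Matrix (Fin N) (Fin N) ℂ)‖ + ‖(X ⟨p.src, p.ν⟩ : Matrix (Fin N) (Fin N) ℂ) - (X' ⟨p.src, p.ν⟩ : Matrix (Fin N) (Fin N) ℂ)‖ := by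
    rw [show ((X ⟨p.src, p.μ⟩ : Matrix (Fin N) (Fin N) ℂ) + (X ⟨p.src.shift p.μ, p.ν⟩ : Matrix (Fin N) (Fin N) ℂ) - (X ⟨p.src.shift p.ν, p.μ⟩ : Matrix (Fin N) (Fin N) ℂ) - (X ⟨p.src, p.ν⟩ : Matrix (Fin N) (Fin N) ℂ)) - ((X' ⟨p.src, p.μ⟩ : Matrix (Fin N) (Fin N) ℂ) + (X' ⟨p.src.shift p.μ, p.ν⟩ : Matrix (Fin N) (Fin N) ℂ) - (X' ⟨p.src.shift p.ν, p.μ⟩ : Matrix (Fin N) (Fin N) ℂ) - (X' ⟨p.src, p.ν⟩ : Matrix (Fin N) (Fin N) ℂ))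
        = ((X ⟨p.src, p.μ⟩ : Matrix (Fin N) (Fin N) ℂ) - (X' ⟨p.src, p.μ⟩ : Matrix (Fin N) (Fin N) ℂ)) + ((X ⟨p.src.shift p.μ, p.ν⟩ : Matrix (Fin N) (Fin N) ℂ) - (X' ⟨p.src.shift p.μ, p.ν⟩ : Matrix (Fin N) (Fin N) ℂ))
          - ((X ⟨p.src.shift p.ν, p.μ⟩ : Matrix (Fin N) (Fin N) ℂ) - (X' ⟨p.src.shift p.ν, p.μ⟩ : Matrix (Fin N) (Fin N) ℂ)) - ((X ⟨p.src, p.ν⟩ : Matrix (Fin N) (Fin N) ℂ) - (X' ⟨p.src, p.ν⟩ : Matrix (Fin N) (Fin N) ℂ)) by abel]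
    exact (norm_sub_le _ _).trans (add_le_add ((norm_sub_le _ _).trans (add_le_add (norm_add_le _ _) le_rfl)) le_rfl)
  exact mul_le_mul (add_le_add (hσ X) (hσ X')) hd (norm_nonneg _) (by positivity)

/-- ★★ **LETTER (b) IN THE LEFT CHART**: if `‖U_b − 1‖ ≤ δ_p` on the four bonds of each plaquette `p` (any budget where `Y` vanishes on `∂p`), then
`|Q^L_U(Y) − Q_1(Y)| ≤ 8·Σ_p δ_p·(Σ_k‖Y_{b_k}‖)²` — `4` from p587195's right-chart comparison at `X = Ad_{U⁻¹}Y` (same letter norms) and `4` from `|Q_1(Ad_{U⁻¹}Y) − Q_1(Y)|`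
(`abs_flat_sub_flat_le` with `‖Ad_{U_b⁻¹}Y_b − Y_b‖ ≤ 2δ_p‖Y_b‖`). [B16] p.357: «we expand … with respect to A₀, up to the first order in A₀ … the leading term … background field identically equal to 1».
[cite: Balaban1989LargeFieldII, p.357, (1.7) p.358; Balaban1985BackgroundPropagators, (3.10) p.392] -/
theorem abs_deriv_deriv_wilsonAction4_leftChart_sub_flat_le_local (U : GaugeField P j (SU N)) (Y : PBond P j → lieSU (Fin N)) (δ : Plaq P j → ℝ)
    (hδ : ∀ p : Plaq P j, ‖(U ⟨p.src, p.μ⟩ : Matrix (Fin N) (Fin N) ℂ) - 1‖ ≤ δ p ∧ ‖(U ⟨p.src.shift p.μ, p.ν⟩ : Matrix (Fin N) (Fin N) ℂ) - 1‖ ≤ δ p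
      ∧ ‖(U ⟨p.src.shift p.ν, p.μ⟩ : Matrix (Fin N) (Fin N) ℂ) - 1‖ ≤ δ p ∧ ‖(U ⟨p.src, p.ν⟩ : Matrix (Fin N) (Fin N) ℂ) - 1‖ ≤ δ p) :
    |deriv (deriv fun t : ℝ => wilsonAction4 (fun b => expSU ((t • Y) b) * U b)) 0
        - deriv (deriv fun t : ℝ => wilsonAction4 (expChart (1 : GaugeField P j (SU N)) (t • Y))) 0|
      ≤ 8 * ∑ p : Plaq P j, δ p * (‖(Y ⟨p.src, p.μ⟩ : Matrix (Fin N) (Fin N) ℂ)‖ + ‖(Y ⟨p.src.shift p.μ, p.ν⟩ : Matrix (Fin N) (Fin N) ℂ)‖ + ‖(Y ⟨p.src.shift p.ν, p.μ⟩ : Matrix (Fin N) (Fin N) ℂ)‖ + ‖(Y ⟨p.src, p.ν⟩ : Matrix (Fin N) (Fin N) ℂ)‖) ^ 2 := by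
  rw [deriv_deriv_wilsonAction4_leftChart_eq]
  set X : PBond P j → lieSU (Fin N) := fun b => specialUnitaryAd (U b)⁻¹ (Y b) with hX
  have hXn : ∀ b, ‖(X b : Matrix (Fin N) (Fin N) ℂ)‖ = ‖(Y b : Matrix (Fin N) (Fin N) ℂ)‖ := fun b => norm_coe_specialUnitaryAd _ _
  have hXd : ∀ b, ‖(X b : Matrix (Fin N) (Fin N) ℂ) - (Y b : Matrix (Fin N) (Fin N) ℂ)‖ ≤ 2 * ‖(U b : Matrix (Fin N) (Fin N) ℂ) - 1‖ * ‖(Y b : Matrix (Fin N) (Fin N) ℂ)‖ := fun b => norm_coe_specialUnitaryAd_inv_sub_le _ _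
  have h1 := abs_deriv_deriv_wilsonAction4_expChart_sub_flat_le_local U X δ hδ
  have h2 := abs_flat_sub_flat_le (N := N) X Y
  simp only [hXn] at h1 h2
  have h3 : ∑ p : Plaq P j, ((‖(Y ⟨p.src, p.μ⟩ : Matrix (Fin N) (Fin N) ℂ)‖ + ‖(Y ⟨p.src.shift p.μ, p.ν⟩ : Matrix (Fin N) (Fin N) ℂ)‖ + ‖(Y ⟨p.src.shift p.ν, p.μ⟩ : Matrix (Fin N) (Fin N) ℂ)‖ + ‖(Y ⟨p.src, p.ν⟩ : Matrix (Fin N) (Fin N) ℂ)‖) + (‖(Y ⟨p.src, p.μ⟩ : Matrix (Fin N) (Fin N) ℂ)‖ + ‖(Y ⟨p.src.shift p.μ, p.ν⟩ : Matrix (Fin N) (Fin N) ℂ)‖ + ‖(Y ⟨p.src.shift p.ν, p.μ⟩ : Matrix (Fin N) (Fin N) ℂ)‖ + ‖(Y ⟨p.src, p.ν⟩ : Matrix (Fin N) (Fin N) ℂ)‖))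
      * (‖(X ⟨p.src, p.μ⟩ : Matrix (Fin N) (Fin N) ℂ) - (Y ⟨p.src, p.μ⟩ : Matrix (Fin N) (Fin N) ℂ)‖ + ‖(X ⟨p.src.shift p.μ, p.ν⟩ : Matrix (Fin N) (Fin N) ℂ) - (Y ⟨p.src.shift p.μ, p.ν⟩ : Matrix (Fin N) (Fin N) ℂ)‖
        + ‖(X ⟨p.src.shift p.ν, p.μ⟩ : Matrix (Fin N) (Fin N) ℂ) - (Y ⟨p.src.shift p.ν, p.μ⟩ : Matrix (Fin N) (Fin N) ℂ)‖ + ‖(X ⟨p.src, p.ν⟩ : Matrix (Fin N) (Fin N) ℂ) - (Y ⟨p.src, p.ν⟩ : Matrix (Fin N) (Fin N) ℂ)‖)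
      ≤ 4 * ∑ p : Plaq P j, δ p * (‖(Y ⟨p.src, p.μ⟩ : Matrix (Fin N) (Fin N) ℂ)‖ + ‖(Y ⟨p.src.shift p.μ, p.ν⟩ : Matrix (Fin N) (Fin N) ℂ)‖ + ‖(Y ⟨p.src.shift p.ν, p.μ⟩ : Matrix (Fin N) (Fin N) ℂ)‖ + ‖(Y ⟨p.src, p.ν⟩ : Matrix (Fin N) (Fin N) ℂ)‖) ^ 2 := by
    rw [Finset.mul_sum]
    refine Finset.sum_le_sum fun p _ => ?_
    have hδp : 0 ≤ δ p := (norm_nonneg _).trans (hδ p).1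
    have e1 := (hXd ⟨p.src, p.μ⟩).trans (mul_le_mul_of_nonneg_right (mul_le_mul_of_nonneg_left (hδ p).1 (by norm_num)) (norm_nonneg _))
    have e2 := (hXd ⟨p.src.shift p.μ, p.ν⟩).trans (mul_le_mul_of_nonneg_right (mul_le_mul_of_nonneg_left (hδ p).2.1 (by norm_num)) (norm_nonneg _))
    have e3 := (hXd ⟨p.src.shift p.ν, p.μ⟩).trans (mul_le_mul_of_nonneg_right (mul_le_mul_of_nonneg_left (hδ p).2.2.1 (by norm_num)) (norm_nonneg _))
    have e4 := (hXd ⟨p.src, p.ν⟩).trans (mul_le_mul_of_nonneg_right (mul_le_mul_of_nonneg_left (hδ p).2.2.2 (by norm_num)) (norm_nonneg _))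
    have hs : 0 ≤ (‖(Y ⟨p.src, p.μ⟩ : Matrix (Fin N) (Fin N) ℂ)‖ + ‖(Y ⟨p.src.shift p.μ, p.ν⟩ : Matrix (Fin N) (Fin N) ℂ)‖ + ‖(Y ⟨p.src.shift p.ν, p.μ⟩ : Matrix (Fin N) (Fin N) ℂ)‖ + ‖(Y ⟨p.src, p.ν⟩ : Matrix (Fin N) (Fin N) ℂ)‖) := by positivity
    calc ((‖(Y ⟨p.src, p.μ⟩ : Matrix (Fin N) (Fin N) ℂ)‖ + ‖(Y ⟨p.src.shift p.μ, p.ν⟩ : Matrix (Fin N) (Fin N) ℂ)‖ + ‖(Y ⟨p.src.shift p.ν, p.μ⟩ : Matrix (Fin N) (Fin N) ℂ)‖ + ‖(Y ⟨p.src, p.ν⟩ : Matrix (Fin N) (Fin N) ℂ)‖) + (‖(Y ⟨p.src, p.μ⟩ : Matrix (Fin N) (Fin N) ℂ)‖ + ‖(Y ⟨p.src.shift p.μ, p.ν⟩ : Matrix (Fin N) (Fin N) ℂ)‖ + ‖(Y ⟨p.src.shift p.ν, p.μ⟩ : Matrix (Fin N) (Fin N) ℂ)‖ + ‖(Y ⟨p.src,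 p.ν⟩ : Matrix (Fin N) (Fin N) ℂ)‖))
          * (‖(X ⟨p.src, p.μ⟩ : Matrix (Fin N) (Fin N) ℂ) - (Y ⟨p.src, p.μ⟩ : Matrix (Fin N) (Fin N) ℂ)‖ + ‖(X ⟨p.src.shift p.μ, p.ν⟩ : Matrix (Fin N) (Fin N) ℂ) - (Y ⟨p.src.shift p.μ, p.ν⟩ : Matrix (Fin N) (Fin N) ℂ)‖
            + ‖(X ⟨p.src.shift p.ν, p.μ⟩ : Matrix (Fin N) (Fin N) ℂ) - (Y ⟨p.src.shift p.ν, p.μ⟩ : Matrix (Fin N) (Fin N) ℂ)‖ + ‖(X ⟨p.src, p.ν⟩ : Matrix (Fin N) (Fin N) ℂ) - (Y ⟨p.src, p.ν⟩ : Matrix (Fin N) (Fin N) ℂ)‖)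
        ≤ ((‖(Y ⟨p.src, p.μ⟩ : Matrix (Fin N) (Fin N) ℂ)‖ + ‖(Y ⟨p.src.shift p.μ, p.ν⟩ : Matrix (Fin N) (Fin N) ℂ)‖ + ‖(Y ⟨p.src.shift p.ν, p.μ⟩ : Matrix (Fin N) (Fin N) ℂ)‖ + ‖(Y ⟨p.src, p.ν⟩ : Matrix (Fin N) (Fin N) ℂ)‖) + (‖(Y ⟨p.src, p.μ⟩ : Matrix (Fin N) (Fin N) ℂ)‖ + ‖(Y ⟨p.src.shift p.μ, p.ν⟩ : Matrix (Fin N) (Fin N) ℂ)‖ + ‖(Y ⟨p.src.shift p.ν, p.μ⟩ : Matrix (Fin N) (Fin N) ℂ)‖ + ‖(Y ⟨p.src, p.ν⟩ : Matrix (Fin N) (Fin N) ℂ)‖))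
          * (2 * δ p * ‖(Y ⟨p.src, p.μ⟩ : Matrix (Fin N) (Fin N) ℂ)‖ + 2 * δ p * ‖(Y ⟨p.src.shift p.μ, p.ν⟩ : Matrix (Fin N) (Fin N) ℂ)‖ + 2 * δ p * ‖(Y ⟨p.src.shift p.ν, p.μ⟩ : Matrix (Fin N) (Fin N) ℂ)‖ + 2 * δ p * ‖(Y ⟨p.src, p.ν⟩ : Matrix (Fin N) (Fin N) ℂ)‖) :=
          mul_le_mul_of_nonneg_left (add_le_add (add_le_add (add_le_add e1 e2) e3) e4) (by positivity)
      _ = 4 * (δ p * (‖(Y ⟨p.src, p.μ⟩ : Matrix (Fin N) (Fin N) ℂ)‖ + ‖(Y ⟨p.src.shift p.μ, p.ν⟩ : Matrix (Fin N) (Fin N) ℂ)‖ + ‖(Y ⟨p.src.shift p.ν, p.μ⟩ : Matrix (Fin N) (Fin N) ℂ)‖ + ‖(Y ⟨p.src, p.ν⟩ : Matrix (Fin N) (Fin N) ℂ)‖) ^ 2) := by ring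
  calc |deriv (deriv fun t : ℝ => wilsonAction4 (expChart U (t • X))) 0 - deriv (deriv fun t : ℝ => wilsonAction4 (expChart (1 : GaugeField P j (SU N)) (t • Y))) 0|
      ≤ |deriv (deriv fun t : ℝ => wilsonAction4 (expChart U (t • X))) 0 - deriv (deriv fun t : ℝ => wilsonAction4 (expChart (1 : GaugeField P j (SU N)) (t • X))) 0|
        + |deriv (deriv fun t : ℝ => wilsonAction4 (expChart (1 : GaugeField P j (SU N)) (t • X))) 0
            - deriv (deriv fun t : ℝ => wilsonAction4 (expChart (1 : GaugeField P j (SU N)) (t • Y))) 0| := abs_sub_le _ _ _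
    _ ≤ 4 * ∑ p : Plaq P j, δ p * (‖(Y ⟨p.src, p.μ⟩ : Matrix (Fin N) (Fin N) ℂ)‖ + ‖(Y ⟨p.src.shift p.μ, p.ν⟩ : Matrix (Fin N) (Fin N) ℂ)‖ + ‖(Y ⟨p.src.shift p.ν, p.μ⟩ : Matrix (Fin N) (Fin N) ℂ)‖ + ‖(Y ⟨p.src, p.ν⟩ : Matrix (Fin N) (Fin N) ℂ)‖) ^ 2 + 4 * ∑ p : Plaq P j, δ p * (‖(Y ⟨p.src, p.μ⟩ : Matrix (Fin N) (Fin N) ℂ)‖ + ‖(Y ⟨p.src.shift p.μ, p.ν⟩ : Matrix (Fin N) (Fin N) ℂ)‖ + ‖(Y ⟨p.src.shift p.ν, p.μ⟩ : Matrix (Fin N) (Fin N) ℂ)‖ + ‖(Y ⟨p.src, p.ν⟩ : Matrix (Fin N) (Fin N) ℂ)‖) ^ 2 := add_le_add h1 (h2.trans h3)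
    _ = 8 * ∑ p : Plaq P j, δ p * (‖(Y ⟨p.src, p.μ⟩ : Matrix (Fin N) (Fin N) ℂ)‖ + ‖(Y ⟨p.src.shift p.μ, p.ν⟩ : Matrix (Fin N) (Fin N) ℂ)‖ + ‖(Y ⟨p.src.shift p.ν, p.μ⟩ : Matrix (Fin N) (Fin N) ℂ)‖ + ‖(Y ⟨p.src, p.ν⟩ : Matrix (Fin N) (Fin N) ℂ)‖) ^ 2 := by ring

end Letters

/-! ## §3  At `SU(2)`: n12-c's slice chart `expMul su2Chart` at a general background is NODE 00's right chart — one rewrite -/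

section SU2Chart

open B16Sect1Backgrounds (expMul)
open B15Prop1ChartSU2 (su2Chart su2Chart_iexp)
open T4CubeChartGnomonic (SU2)
open T4HaarSU2ExpChart (imQuat)
open Literature.MathematicalPhysics.QuantumLattice (quatMatrix)
open B16Ineq19FlatSliceChart (expPoint_eq_expSU)

variable {P : Params} {k : ℕ} {φ : EuclideanSpace ℝ (Fin 3) →ₗ[ℝ] lieSU (Fin 2)}

/-- ★ (iii) **THE SLICE CHAIN'S LEFT CHART AT A GENERAL BACKGROUND**: `expMul su2Chart A U = expChart U (b ↦ Ad_{U_b⁻¹}(φ(A_b)))` for ANY coordinate `φ : ℝ³ → 𝔰𝔲(2)` with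
`↑(φ v) = quatMatrix (ι v)` (dag-n12-w3's hypothesis-style `φ`, `expPoint_eq_expSU`; at `U = 1` this is his `expMul_su2Chart_one_eq_expChart`).
[cite: Balaban1989LargeFieldII, (1.19) p.360; Balaban1989LargeFieldI, (1.74) p.192] -/
theorem expMul_su2Chart_eq_expChart (hφ : ∀ v, ((φ v : lieSU (Fin 2)) : Matrix (Fin 2) (Fin 2) ℂ) = quatMatrix (imQuat v))
    (A : VecField P k (EuclideanSpace ℝ (Fin 3))) (U : GaugeField P k SU2) :
    expMul su2Chart A U = expChart U (fun b => specialUnitaryAd (U b)⁻¹ (φ (A b))) := by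
  funext b
  show su2Chart.iexp (A b) * U b = U b * expSU (specialUnitaryAd (U b)⁻¹ (φ (A b)))
  rw [su2Chart_iexp, expPoint_eq_expSU hφ]
  exact expSU_mul_eq_mul_expSU (φ (A b)) (U b)

/-- The ray version: `expMul su2Chart (s•A) U = expChart U (s • (Ad_{U⁻¹} ∘ φ ∘ A))`. [cite: Balaban1989LargeFieldII, (1.19) p.360 (bookkeeping)] -/
theorem expMul_su2Chart_smul_eq_expChart (hφ : ∀ v, ((φ v : lieSU (Fin 2)) : Matrix (Fin 2) (Fin 2) ℂ) = quatMatrix (imQuat v))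
    (A : VecField P k (EuclideanSpace ℝ (Fin 3))) (U : GaugeField P k SU2) (s : ℝ) :
    expMul su2Chart (s • A) U = expChart U (s • fun b => specialUnitaryAd (U b)⁻¹ (φ (A b))) := by
  rw [expMul_su2Chart_eq_expChart hφ]
  congr 1
  funext b
  simp only [Pi.smul_apply, map_smul]

/-- **ONE REWRITE FOR EVERY CONSUMER**: along the slice chain's ray, the Wilson action of ANY function of the perturbed field factors through NODE 00's right chart —
`(s ↦ f (expMul su2Chart (s•A) U)) = (s ↦ f (expChart U (s • Ad_{U⁻¹}(φ∘A))))`; with `f = wilsonAction4 ∘ (background map)` the U2a files apply at `X := Ad_{U⁻¹}(φ∘A)`.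
[cite: Balaban1989LargeFieldII, p.359 («we consider the variational problem for the function V′↾_Λ → A(U_{k,Z}(V′Ṽ_k))»), (1.19) p.360] -/
theorem comp_expMul_su2Chart_smul_eq (hφ : ∀ v, ((φ v : lieSU (Fin 2)) : Matrix (Fin 2) (Fin 2) ℂ) = quatMatrix (imQuat v))
    {α : Type*} (f : GaugeField P k SU2 → α) (A : VecField P k (EuclideanSpace ℝ (Fin 3))) (U : GaugeField P k SU2) :
    (fun s : ℝ => f (expMul su2Chart (s • A) U)) = fun s : ℝ => f (expChart U (s • fun b => specialUnitaryAd (U b)⁻¹ (φ (A b)))) := by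
  funext s
  rw [expMul_su2Chart_smul_eq_expChart hφ]

end SU2Chart

end Literature.MathematicalPhysics.QuantumFieldTheory.Balaban1983to89.Node00

end
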